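import Mathlib
import Summits.HubbardSuperconductivity.HubbardSuperconductivity.Theorems.NodalWardXYVisonPairCostIRDefs
import Summits.HubbardSuperconductivity.HubbardSuperconductivity.Theorems.NodalWardXYVisonPairCostLogDetFormula
import Summits.HubbardSuperconductivity.HubbardSuperconductivity.Theorems.NodalWardXYVisonPairCostUltraviolet

/-!
# Crux `NodalWardXY.VisonPairCost` (stmt-HubbardSuperconductivity-1266), line `Sketch`:
# the resolvent bound `stub_resolventBound : MirrorSetup → ResolventBound`

Statement (IR-3) of `…VisonPairCostIRDefs`: for the crossing blocks `X₁ = P_A G P_B V P_B`,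
`X₂ = P_B (UGU) P_A V P_A` of the gauge mirror (`G = (N₀ + it)⁻¹`, `N₀ = visonNambu L μ Δ₀ 0`,
`U = mirU`, `V = mirV = U N₀ U − N₀`, `P_A = projA`, `P_B = projB`),
`‖v‖² ≤ (2 + c/t)⁴ ‖(1 + X₁X₂) v‖²` with `c = 2 (8 + 8|Δ₀| + |μ|)` (twice the row-sum bound of the
Nambu matrices, `visonNambu_row_le`).

Proof (pure finite-dimensional linear algebra in the `L²` operator norm of matrices, Mathlib's scoped
`Matrix.Norms.L2Operator`; the abstract core is `rb_block_resolvent_bound`):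
* `X₁X₂ = P_A M`, `M = G V_B G' V_A` (`V_A = P_A V P_A`, `V_B = P_B V P_B`, `G' = UGU = (N₀ + V + it)⁻¹`);
* resolvent identity `G V G' = G − G'` and `V = V_A + V_B` (from `MirrorSetup`) give the factorisation
  `1 + M = (1 + G V_A)(1 − G' V_A)`;
* `1 + G V_A = G (N₀ + V_A + it)` and `1 − G' V_A = G' (N₀ + V_B + it)`, so with the Hermitian resolvents
  `G_R = (N₀ + V_A + it)⁻¹`, `G_B = (N₀ + V_B + it)⁻¹` the matrix `T = (1 + G_B V_A)(1 − G_R V_A)` is a right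
  inverse of `1 + M`, of norm `≤ (1 + c/t)²` (`‖(N + it)⁻¹‖ ≤ 1/t` for Hermitian `N`:
  `‖(N + it)u‖² = ‖Nu‖² + t²‖u‖²`; `‖V_A‖ ≤ c` by Schur's test, `V_A = N_R − N₀` from `MirrorSetup`);
* block inverse: `(1 + P_A M)((1 − P_A) + P_A T P_A) = 1` (using `M P_A = M`), hence
  `v = ((1 − P_A) + P_A T P_A)(1 + X₁X₂)v` and `‖v‖ ≤ (1 + (1 + c/t)²)‖(1 + X₁X₂)v‖ ≤ (2 + c/t)²‖(1 + X₁X₂)v‖`.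
References: the crux docstring (`Theses/NodalWardXY.lean`), crux idea `gauge-mirror-logdet`; tree lemmas
`isHermitian_visonNambu` (`…RankWindow`), `visonNambu_row_le` (`…Ultraviolet`), `det_add_I_smul_ne_zero`
(`…LogDetFormula`); Mathlib `Matrix.l2_opNorm_mulVec`, `Matrix.l2_opNorm_diagonal`,
`Matrix.isSymmetric_toEuclideanLin_iff`.  No definition is introduced.
-/

noncomputable section

-- tree namespace Summit.HubbardSuperconductivity.HubbardSuperconductivity (D-0017)
set_option linter.dupNamespace false

namespace Summit.HubbardSuperconductivity.HubbardSuperconductivity.Theorems.VisonPairCost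

open Literature.Probability.LatticeModels Literature.MathematicalPhysics.QuantumLattice
open scoped Matrix Matrix.Norms.L2Operator ComplexConjugate InnerProductSpace

/-! ## Toolkit: Euclidean norms of coordinate vectors and `L²` operator norms of matrices -/

section VecToolkit

variable {n : Type*} [Fintype n]

/-- `‖v‖₂² = Re (v⋆ ⬝ v)` for a coordinate vector (norm of `EuclideanSpace ℂ n`). [folklore] -/
theorem rb_norm_toLp_sq (v : n → ℂ) :
    ‖(WithLp.toLp 2 v : EuclideanSpace ℂ n)‖ ^ 2 = (star v ⬝ᵥ v).re := by
  rw [@norm_sq_eq_re_inner ℂ, EuclideanSpace.inner_toLp_toLp, dotProduct_comm]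
  rfl

/-- `Re (v⋆ ⬝ v) ≥ 0`. [folklore] -/
theorem rb_re_star_dotProduct_self_nonneg (v : n → ℂ) : 0 ≤ (star v ⬝ᵥ v).re := by
  rw [← rb_norm_toLp_sq]; positivity

/-- **Schur's test** (sums form): if all absolute row sums and column sums of `A` are `≤ K` then
`Σ_i |(A v)_i|² ≤ K² Σ_j |v_j|²`. [folklore] -/
theorem rb_sum_norm_sq_mulVec_le {A : Matrix n n ℂ} {K : ℝ}
    (hrow : ∀ i, ∑ j, ‖A i j‖ ≤ K) (hcol : ∀ j, ∑ i, ‖A i j‖ ≤ K) (v : n → ℂ) :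
    ∑ i, ‖(A *ᵥ v) i‖ ^ 2 ≤ K ^ 2 * ∑ j, ‖v j‖ ^ 2 := by
  classical
  rcases isEmpty_or_nonempty n with hn | ⟨⟨i₀⟩⟩
  · simp
  have hK : 0 ≤ K := (Finset.sum_nonneg fun j _ => norm_nonneg (A i₀ j)).trans (hrow i₀)
  have h1 : ∀ i, ‖(A *ᵥ v) i‖ ^ 2 ≤ K * ∑ j, ‖A i j‖ * ‖v j‖ ^ 2 := fun i => by
    have hle : ‖(A *ᵥ v) i‖ ≤ ∑ j, ‖A i j‖ * ‖v j‖ := by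
      rw [Matrix.mulVec_apply_eq_sum]
      exact (norm_sum_le _ _).trans (le_of_eq (Finset.sum_congr rfl fun j _ => norm_mul _ _))
    have hcs : (∑ j, ‖A i j‖ * ‖v j‖) ^ 2 ≤ (∑ j, ‖A i j‖) * ∑ j, ‖A i j‖ * ‖v j‖ ^ 2 :=
      Finset.sum_sq_le_sum_mul_sum_of_sq_le_mul _ (fun j _ => norm_nonneg _)
        (fun j _ => by positivity) (fun j _ => le_of_eq (by ring))
    calc ‖(A *ᵥ v) i‖ ^ 2 ≤ (∑ j, ‖A i j‖ * ‖v j‖) ^ 2 := pow_le_pow_left₀ (norm_nonneg _) hle 2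
      _ ≤ (∑ j, ‖A i j‖) * ∑ j, ‖A i j‖ * ‖v j‖ ^ 2 := hcs
      _ ≤ K * ∑ j, ‖A i j‖ * ‖v j‖ ^ 2 :=
          mul_le_mul_of_nonneg_right (hrow i) (Finset.sum_nonneg fun j _ => by positivity)
  calc ∑ i, ‖(A *ᵥ v) i‖ ^ 2 ≤ ∑ i, K * ∑ j, ‖A i j‖ * ‖v j‖ ^ 2 :=
        Finset.sum_le_sum fun i _ => h1 i
    _ = K * ∑ j, (∑ i, ‖A i j‖) * ‖v j‖ ^ 2 := by
        rw [← Finset.mul_sum, Finset.sum_comm]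
        simp only [Finset.sum_mul]
    _ ≤ K * ∑ j, K * ‖v j‖ ^ 2 := by
        refine mul_le_mul_of_nonneg_left (Finset.sum_le_sum fun j _ => ?_) hK
        exact mul_le_mul_of_nonneg_right (hcol j) (by positivity)
    _ = K ^ 2 * ∑ j, ‖v j‖ ^ 2 := by
        rw [← Finset.mul_sum]; ring

end VecToolkit

section OpToolkit

variable {n : Type*} [Fintype n] [DecidableEq n]

/-- **Operator norm bound on vectors**: `Re ((Av)⋆ ⬝ Av) ≤ ‖A‖² Re (v⋆ ⬝ v)` (`L²` operator norm).
[folklore] -/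
theorem rb_re_star_mulVec_le (A : Matrix n n ℂ) (v : n → ℂ) :
    (star (A *ᵥ v) ⬝ᵥ (A *ᵥ v)).re ≤ ‖A‖ ^ 2 * (star v ⬝ᵥ v).re := by
  rw [← rb_norm_toLp_sq, ← rb_norm_toLp_sq, ← mul_pow]
  have h : ‖(WithLp.toLp 2 (A *ᵥ v) : EuclideanSpace ℂ n)‖ ≤
      ‖A‖ * ‖(WithLp.toLp 2 v : EuclideanSpace ℂ n)‖ :=
    Matrix.l2_opNorm_mulVec A (WithLp.toLp 2 v : EuclideanSpace ℂ n)
  exact pow_le_pow_left₀ (norm_nonneg _) h 2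

/-- **Schur's test for a Hermitian matrix**: absolute row sums `≤ K` force `‖A‖ ≤ K` in the `L²`
operator norm. [folklore] -/
theorem rb_l2_opNorm_le_of_isHermitian {A : Matrix n n ℂ} (hA : A.IsHermitian) {K : ℝ}
    (hK : 0 ≤ K) (hrow : ∀ i, ∑ j, ‖A i j‖ ≤ K) : ‖A‖ ≤ K := by
  have hcol : ∀ j, ∑ i, ‖A i j‖ ≤ K := fun j =>
    le_of_eq_of_le (Finset.sum_congr rfl fun i _ => by rw [← hA.apply i j, norm_star]) (hrow j)
  rw [Matrix.cstar_norm_def]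
  refine ContinuousLinearMap.opNorm_le_bound _ hK fun x => ?_
  rw [← sq_le_sq₀ (norm_nonneg _) (by positivity), mul_pow, EuclideanSpace.norm_sq_eq,
    EuclideanSpace.norm_sq_eq]
  exact rb_sum_norm_sq_mulVec_le hrow hcol (WithLp.ofLp x)

/-- **Resolvent bound at imaginary energy**: for Hermitian `A` and `t > 0`,
`‖(A + it)⁻¹‖ ≤ 1/t` (`‖(A + it)u‖² = ‖Au‖² + t²‖u‖²`). [folklore] -/
theorem rb_l2_opNorm_resolvent_le {A : Matrix n n ℂ} (hA : A.IsHermitian) {t : ℝ} (ht : 0 < t) :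
    ‖(A + ((t : ℂ) * Complex.I) • (1 : Matrix n n ℂ))⁻¹‖ ≤ 1 / t := by
  set S : Matrix n n ℂ := A + ((t : ℂ) * Complex.I) • (1 : Matrix n n ℂ) with hS
  have hdet : IsUnit S.det := (det_add_I_smul_ne_zero hA ht.ne').isUnit
  have hSG : S * S⁻¹ = 1 := Matrix.mul_nonsing_inv S hdet
  rw [Matrix.cstar_norm_def]
  refine ContinuousLinearMap.opNorm_le_bound _ (by positivity) fun x => ?_
  set u : EuclideanSpace ℂ n := Matrix.toEuclideanCLM (n := n) (𝕜 := ℂ) S⁻¹ x with hu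
  have hx : Matrix.toEuclideanCLM (n := n) (𝕜 := ℂ) S u = x := by
    show (Matrix.toEuclideanCLM (n := n) (𝕜 := ℂ) S * Matrix.toEuclideanCLM (n := n) (𝕜 := ℂ) S⁻¹) x = x
    rw [← map_mul, hSG, map_one]
    rfl
  have hdecomp : Matrix.toEuclideanCLM (n := n) (𝕜 := ℂ) S u =
      Matrix.toEuclideanCLM (n := n) (𝕜 := ℂ) A u + ((t : ℂ) * Complex.I) • u := by
    rw [hS, map_add, map_smul, map_one]
    rfl
  have hsym : ((Matrix.toEuclideanCLM (n := n) (𝕜 := ℂ) A : EuclideanSpace ℂ n →L[ℂ]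
      EuclideanSpace ℂ n) : EuclideanSpace ℂ n →ₗ[ℂ] EuclideanSpace ℂ n).IsSymmetric := by
    rw [Matrix.coe_toEuclideanCLM_eq_toEuclideanLin]
    exact Matrix.isSymmetric_toEuclideanLin_iff.mpr hA
  have hcross : RCLike.re (⟪Matrix.toEuclideanCLM (n := n) (𝕜 := ℂ) A u,
      ((t : ℂ) * Complex.I) • u⟫_ℂ) = 0 := by
    rw [inner_smul_right, ← hsym.coe_reApplyInnerSelf_apply]
    simp
  have hnorm : ‖x‖ ^ 2 = ‖Matrix.toEuclideanCLM (n := n) (𝕜 := ℂ) A u‖ ^ 2 + (t * ‖u‖) ^ 2 := by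
    rw [← hx, hdecomp, @norm_add_sq ℂ, hcross, norm_smul, mul_zero, add_zero]
    simp [abs_of_pos ht]
  have hle : (t * ‖u‖) ^ 2 ≤ ‖x‖ ^ 2 := by rw [hnorm]; nlinarith [sq_nonneg ‖Matrix.toEuclideanCLM (n := n) (𝕜 := ℂ) A u‖]
  have hle' : t * ‖u‖ ≤ ‖x‖ := (sq_le_sq₀ (by positivity) (norm_nonneg _)).mp hle
  rw [div_mul_eq_mul_div, one_mul, le_div_iff₀ ht, mul_comm]
  exact hle'

/-- A diagonal matrix with entries of modulus `≤ 1` has `L²` operator norm `≤ 1`. [folklore] -/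
theorem rb_l2_opNorm_diagonal_le {d : n → ℂ} (hd : ∀ i, ‖d i‖ ≤ 1) : ‖Matrix.diagonal d‖ ≤ 1 := by
  rw [Matrix.l2_opNorm_diagonal]
  exact (pi_norm_le_iff_of_nonneg zero_le_one).mpr hd

/-- **Abstract block-resolvent bound** (the algebraic heart of `ResolventBound`). For Hermitian `M₀`,
a self-adjoint involution `U`, `V = U M₀ U − M₀` split as `P_A V P_A + P_B V P_B` by self-adjoint
idempotents, `G` a right inverse of `M₀ + it` (`t > 0`), `‖P_A‖, ‖1 − P_A‖ ≤ 1` and `‖P_A V P_A‖ ≤ c`: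
`Re(v⋆v) ≤ (2 + c/t)⁴ Re(w⋆w)`, `w = (1 + X₁X₂)v`, `X₁ = P_A G P_B V P_B`, `X₂ = P_B (UGU) P_A V P_A`.
[folklore] -/
theorem rb_block_resolvent_bound (M₀ U V PA PB G : Matrix n n ℂ) {t c : ℝ} (ht : 0 < t)
    (hc : 0 ≤ c) (hM₀ : M₀.IsHermitian) (hUU : U * U = 1) (hUH : Uᴴ = U)
    (hV : V = U * M₀ * U - M₀) (hPAH : PAᴴ = PA) (hPAPA : PA * PA = PA) (hPBH : PBᴴ = PB)
    (hPBPB : PB * PB = PB) (hsplit : V = PA * V * PA + PB * V * PB)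
    (hSG : (M₀ + ((t : ℂ) * Complex.I) • (1 : Matrix n n ℂ)) * G = 1)
    (hnPA : ‖PA‖ ≤ 1) (hn1PA : ‖1 - PA‖ ≤ 1) (hnVA : ‖PA * V * PA‖ ≤ c) (v : n → ℂ) :
    (star v ⬝ᵥ v).re ≤ (2 + c / t) ^ 4 *
      (star ((1 + PA * G * PB * V * PB * (PB * (U * G * U) * PA * V * PA)) *ᵥ v) ⬝ᵥ
        ((1 + PA * G * PB * V * PB * (PB * (U * G * U) * PA * V * PA)) *ᵥ v)).re := by
  -- abbreviations
  set z : ℂ := (t : ℂ) * Complex.I with hzdef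
  set S : Matrix n n ℂ := M₀ + z • (1 : Matrix n n ℂ) with hSdef
  set VA : Matrix n n ℂ := PA * V * PA with hVAdef
  set VB : Matrix n n ℂ := PB * V * PB with hVBdef
  set G' : Matrix n n ℂ := U * G * U with hG'def
  set SV : Matrix n n ℂ := M₀ + V + z • (1 : Matrix n n ℂ) with hSVdef
  set SA : Matrix n n ℂ := M₀ + VA + z • (1 : Matrix n n ℂ) with hSAdef
  set SB : Matrix n n ℂ := M₀ + VB + z • (1 : Matrix n n ℂ) with hSBdef
  have hGS : G * S = 1 := mul_eq_one_comm.mp hSG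
  -- Hermitian parts and the two perturbed resolvents
  have hVH : Vᴴ = V := by
    rw [hV, Matrix.conjTranspose_sub, Matrix.conjTranspose_mul, Matrix.conjTranspose_mul, hUH,
      hM₀.eq, ← mul_assoc]
  have hVAH : (M₀ + VA).IsHermitian := by
    refine hM₀.add ?_
    show VAᴴ = VA
    rw [hVAdef, Matrix.conjTranspose_mul, Matrix.conjTranspose_mul, hPAH, hVH, ← mul_assoc]
  have hVBH : (M₀ + VB).IsHermitian := by
    refine hM₀.add ?_
    show VBᴴ = VB
    rw [hVBdef, Matrix.conjTranspose_mul, Matrix.conjTranspose_mul, hPBH, hVH, ← mul_assoc]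
  have hSAu : IsUnit SA.det := (det_add_I_smul_ne_zero hVAH ht.ne').isUnit
  have hSBu : IsUnit SB.det := (det_add_I_smul_ne_zero hVBH ht.ne').isUnit
  set GR : Matrix n n ℂ := SA⁻¹ with hGRdef
  set GB : Matrix n n ℂ := SB⁻¹ with hGBdef
  have hSAGR : SA * GR = 1 := Matrix.mul_nonsing_inv SA hSAu
  have hGRSA : GR * SA = 1 := Matrix.nonsing_inv_mul SA hSAu
  have hSBGB : SB * GB = 1 := Matrix.mul_nonsing_inv SB hSBu
  have hGBSB : GB * SB = 1 := Matrix.nonsing_inv_mul SB hSBu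
  -- gauge relation `U S U = S_V`, so that `G' = S_V⁻¹`
  have hUU' : ∀ X : Matrix n n ℂ, U * (U * X) = X := fun X => by
    rw [← mul_assoc, hUU, one_mul]
  have hSG' : ∀ X : Matrix n n ℂ, S * (G * X) = X := fun X => by
    rw [← mul_assoc, hSG, one_mul]
  have hGS' : ∀ X : Matrix n n ℂ, G * (S * X) = X := fun X => by
    rw [← mul_assoc, hGS, one_mul]
  have hUMU : U * M₀ * U = M₀ + V := by
    rw [hV]; abel
  have hUSU : U * S * U = SV := by
    rw [hSdef, mul_add, add_mul, hUMU, mul_smul_comm, mul_one, smul_mul_assoc, hUU]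
  have hSVG' : SV * G' = 1 := by
    rw [← hUSU, hG'def]; simp only [mul_assoc, hUU', hSG', hUU]
  have hG'SV : G' * SV = 1 := by
    rw [← hUSU, hG'def]; simp only [mul_assoc, hUU', hGS', hUU]
  -- resolvent identity and the factorisation `1 + M = (1 + G V_A)(1 - G' V_A)`
  have hres : G * V * G' = G - G' := by
    have hVSS : V = SV - S := by
      rw [hSVdef, hSdef]; abel
    rw [hVSS, mul_sub, sub_mul, mul_assoc G SV G', hSVG', mul_one, hGS, one_mul]
  have hVB : VB = V - VA := by
    rw [hsplit]; abel
  set M : Matrix n n ℂ := G * VB * G' * VA with hMdef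
  have hfac : 1 + M = (1 + G * VA) * (1 - G' * VA) := by
    have h1 : G * VB * G' = G - G' - G * VA * G' := by
      rw [hVB, mul_sub, sub_mul, hres]
    rw [hMdef, h1]
    simp only [add_mul, mul_sub, sub_mul, one_mul, mul_one, mul_assoc]
    abel
  -- the right inverse `T = (G_B S_V)(G_R S) = (1 + G_B V_A)(1 - G_R V_A)` of `1 + M`
  have hT1 : (1 + G * VA) * (GR * S) = 1 := by
    have h1 : 1 + G * VA = G * SA := by
      rw [hSAdef, show M₀ + VA + z • (1 : Matrix n n ℂ) = S + VA by rw [hSdef]; abel, mul_add, hGS]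
    rw [h1, mul_assoc, ← mul_assoc SA, hSAGR, one_mul, hGS]
  have hT2 : (1 - G' * VA) * (GB * SV) = 1 := by
    have h2 : 1 - G' * VA = G' * SB := by
      rw [hSBdef, hVB, show M₀ + (V - VA) + z • (1 : Matrix n n ℂ) = SV - VA by rw [hSVdef]; abel,
        mul_sub, hG'SV]
    rw [h2, mul_assoc, ← mul_assoc SB, hSBGB, one_mul, hG'SV]
  set T : Matrix n n ℂ := GB * SV * (GR * S) with hTdef
  have hMT : (1 + M) * T = 1 := by
    rw [hfac, hTdef, mul_assoc, ← mul_assoc (1 - G' * VA) (GB * SV) (GR * S), hT2, one_mul, hT1]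
  have hT1' : GR * S = 1 - GR * VA := by
    have : S = SA - VA := by rw [hSAdef, hSdef]; abel
    rw [this, mul_sub, hGRSA]
  have hT2' : GB * SV = 1 + GB * VA := by
    have : SV = SB + VA := by rw [hSBdef, hSVdef, hVB]; abel
    rw [this, mul_add, hGBSB]
  -- norms
  have hGR : ‖GR‖ ≤ 1 / t := by rw [hGRdef, hSAdef]; exact rb_l2_opNorm_resolvent_le hVAH ht
  have hGB : ‖GB‖ ≤ 1 / t := by rw [hGBdef, hSBdef]; exact rb_l2_opNorm_resolvent_le hVBH ht
  have h1 : ‖(1 : Matrix n n ℂ)‖ ≤ 1 := by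
    rw [← Matrix.diagonal_one]
    exact rb_l2_opNorm_diagonal_le fun _ => by simp
  have hnT1 : ‖GR * S‖ ≤ 1 + c / t := by
    rw [hT1']
    calc ‖1 - GR * VA‖ ≤ ‖(1 : Matrix n n ℂ)‖ + ‖GR * VA‖ := norm_sub_le _ _
      _ ≤ 1 + ‖GR‖ * ‖VA‖ := add_le_add h1 (norm_mul_le _ _)
      _ ≤ 1 + (1 / t) * c := by
          gcongr 1 + ?_
          exact mul_le_mul hGR hnVA (norm_nonneg _) (by positivity)
      _ = 1 + c / t := by ring
  have hnT2 : ‖GB * SV‖ ≤ 1 + c / t := by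
    rw [hT2']
    calc ‖1 + GB * VA‖ ≤ ‖(1 : Matrix n n ℂ)‖ + ‖GB * VA‖ := norm_add_le _ _
      _ ≤ 1 + ‖GB‖ * ‖VA‖ := add_le_add h1 (norm_mul_le _ _)
      _ ≤ 1 + (1 / t) * c := by
          gcongr 1 + ?_
          exact mul_le_mul hGB hnVA (norm_nonneg _) (by positivity)
      _ = 1 + c / t := by ring
  have hct : 0 ≤ c / t := div_nonneg hc ht.le
  have hnT : ‖T‖ ≤ (1 + c / t) ^ 2 := by
    calc ‖T‖ = ‖GB * SV * (GR * S)‖ := rfl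
      _ ≤ ‖GB * SV‖ * ‖GR * S‖ := norm_mul_le _ _
      _ ≤ (1 + c / t) * (1 + c / t) := mul_le_mul hnT2 hnT1 (norm_nonneg _) (by positivity)
      _ = (1 + c / t) ^ 2 := by ring
  -- `X₁ X₂ = P_A M` and the block inverse
  have hPBPB' : ∀ X : Matrix n n ℂ, PB * (PB * X) = PB * X := fun X => by rw [← mul_assoc, hPBPB]
  have hX : PA * G * PB * V * PB * (PB * G' * PA * V * PA) = PA * M := by
    rw [hMdef, hVBdef, hVAdef]; simp only [mul_assoc, hPBPB']
  have hVAPA : VA * PA = VA := by rw [hVAdef, mul_assoc (PA * V) PA PA, hPAPA]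
  have hMPA : M * PA = M := by rw [hMdef, mul_assoc _ VA PA, hVAPA]
  set Inv : Matrix n n ℂ := 1 - PA + PA * T * PA with hInvdef
  have hInv : (1 + PA * M) * Inv = 1 := by
    calc (1 + PA * M) * Inv
        = 1 - PA + PA * ((1 + M) * T) * PA + (PA * M - PA * (M * PA)) +
            (PA * (M * PA) - PA * M) * T * PA := by
          rw [hInvdef]; noncomm_ring
      _ = 1 := by
          rw [hMPA, sub_self, zero_mul, zero_mul, add_zero, add_zero, hMT, mul_one, hPAPA,
            sub_add_cancel]
  have hInv' : Inv * (1 + PA * M) = 1 := mul_eq_one_comm.mp hInv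
  have hnInv : ‖Inv‖ ≤ (2 + c / t) ^ 2 := by
    calc ‖Inv‖ = ‖1 - PA + PA * T * PA‖ := rfl
      _ ≤ ‖1 - PA‖ + ‖PA * T * PA‖ := norm_add_le _ _
      _ ≤ 1 + ‖PA‖ * ‖T‖ * ‖PA‖ :=
          add_le_add hn1PA ((norm_mul_le _ _).trans
            (mul_le_mul_of_nonneg_right (norm_mul_le _ _) (norm_nonneg _)))
      _ ≤ 1 + 1 * (1 + c / t) ^ 2 * 1 :=
          add_le_add le_rfl (mul_le_mul (mul_le_mul hnPA hnT (norm_nonneg _) zero_le_one) hnPA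
            (norm_nonneg _) (by positivity))
      _ ≤ (2 + c / t) ^ 2 := by nlinarith
  -- conclusion
  have hvec : Inv *ᵥ ((1 + PA * M) *ᵥ v) = v := by
    rw [Matrix.mulVec_mulVec, hInv', Matrix.one_mulVec]
  rw [hX]
  calc (star v ⬝ᵥ v).re = (star (Inv *ᵥ ((1 + PA * M) *ᵥ v)) ⬝ᵥ (Inv *ᵥ ((1 + PA * M) *ᵥ v))).re := by
        rw [hvec]
    _ ≤ ‖Inv‖ ^ 2 * (star ((1 + PA * M) *ᵥ v) ⬝ᵥ ((1 + PA * M) *ᵥ v)).re := rb_re_star_mulVec_le _ _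
    _ ≤ ((2 + c / t) ^ 2) ^ 2 * (star ((1 + PA * M) *ᵥ v) ⬝ᵥ ((1 + PA * M) *ᵥ v)).re :=
        mul_le_mul_of_nonneg_right (pow_le_pow_left₀ (norm_nonneg _) hnInv 2)
          (rb_re_star_dotProduct_self_nonneg _)
    _ = (2 + c / t) ^ 4 * (star ((1 + PA * M) *ᵥ v) ⬝ᵥ ((1 + PA * M) *ᵥ v)).re := by ring

end OpToolkit

/-! ## The stub -/

/-- **Resolvent bound** (registered stub `stub_resolventBound` of the line `Sketch`): under the mirror
set-up, `‖v‖² ≤ (2 + c/t)⁴ ‖(1 + X₁X₂)v‖²` for all `v`, with `c = 2 (8 + 8|Δ₀| + |μ|)` independent of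
`L ≥ 4`, `2R ≤ L`, `t > 0`. -/
theorem stub_resolventBound : MirrorSetup → ResolventBound := by
  intro hMS μ Δ₀
  set K : ℝ := 8 + 8 * |Δ₀| + |μ| with hKdef
  have hK0 : 0 ≤ K := by positivity
  refine ⟨2 * K, by positivity, ?_⟩
  intro L _ hL R hR t ht v
  obtain ⟨-, hsplit, hNR⟩ := hMS L hL μ Δ₀ R hR
  have hN0 : (visonNambu L μ Δ₀ 0).IsHermitian := isHermitian_visonNambu μ Δ₀ 0
  have hUU : mirU L * mirU L = 1 := by
    unfold mirU
    rw [Matrix.diagonal_mul_diagonal, ← Matrix.diagonal_one]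
    congr 1; funext o; split_ifs <;> norm_num
  have hUH : (mirU L)ᴴ = mirU L := by
    unfold mirU
    rw [Matrix.diagonal_conjTranspose]
    congr 1; funext o; simp only [Pi.star_apply]; split_ifs <;> simp
  have hPAH : (projA L R)ᴴ = projA L R := by
    unfold projA
    rw [Matrix.diagonal_conjTranspose]
    congr 1; funext o; simp only [Pi.star_apply]; split_ifs <;> simp
  have hPAPA : projA L R * projA L R = projA L R := by
    unfold projA
    rw [Matrix.diagonal_mul_diagonal]
    congr 1; funext o; split_ifs <;> norm_num
  have hPBH : (projB L R)ᴴ = projB L R := by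
    unfold projB
    rw [Matrix.diagonal_conjTranspose]
    congr 1; funext o; simp only [Pi.star_apply]; split_ifs <;> simp
  have hPBPB : projB L R * projB L R = projB L R := by
    unfold projB
    rw [Matrix.diagonal_mul_diagonal]
    congr 1; funext o; split_ifs <;> norm_num
  have hnPA : ‖projA L R‖ ≤ 1 := by
    unfold projA
    exact rb_l2_opNorm_diagonal_le fun o => by split_ifs <;> simp
  have hn1PA : ‖1 - projA L R‖ ≤ 1 := by
    unfold projA
    rw [← Matrix.diagonal_one, Matrix.diagonal_sub]
    exact rb_l2_opNorm_diagonal_le fun o => by split_ifs <;> simp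
  have hnVA : ‖projA L R * mirV L μ Δ₀ * projA L R‖ ≤ 2 * K := by
    have hVA : projA L R * mirV L μ Δ₀ * projA L R = visonNambu L μ Δ₀ R - visonNambu L μ Δ₀ 0 := by
      rw [hNR, add_sub_cancel_left]
    rw [hVA]
    calc ‖visonNambu L μ Δ₀ R - visonNambu L μ Δ₀ 0‖
        ≤ ‖visonNambu L μ Δ₀ R‖ + ‖visonNambu L μ Δ₀ 0‖ := norm_sub_le _ _
      _ ≤ K + K := add_le_add
          (rb_l2_opNorm_le_of_isHermitian (isHermitian_visonNambu μ Δ₀ R) hK0 (visonNambu_row_le μ Δ₀ R))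
          (rb_l2_opNorm_le_of_isHermitian hN0 hK0 (visonNambu_row_le μ Δ₀ 0))
      _ = 2 * K := by ring
  have hdet : IsUnit (visonNambu L μ Δ₀ 0 + ((t : ℂ) * Complex.I) •
      (1 : Matrix (Orb (FermionTorus 2 L)) (Orb (FermionTorus 2 L)) ℂ)).det :=
    (det_add_I_smul_ne_zero hN0 ht.ne').isUnit
  have hSG : (visonNambu L μ Δ₀ 0 + ((t : ℂ) * Complex.I) •
      (1 : Matrix (Orb (FermionTorus 2 L)) (Orb (FermionTorus 2 L)) ℂ)) * freeG L μ Δ₀ t = 1 := by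
    unfold freeG
    exact Matrix.mul_nonsing_inv _ hdet
  have key := rb_block_resolvent_bound (visonNambu L μ Δ₀ 0) (mirU L) (mirV L μ Δ₀) (projA L R)
    (projB L R) (freeG L μ Δ₀ t) ht (by positivity : (0 : ℝ) ≤ 2 * K) hN0 hUU hUH rfl hPAH hPAPA
    hPBH hPBPB hsplit hSG hnPA hn1PA hnVA v
  simpa only [mirX1, mirX2] using key

end Summit.HubbardSuperconductivity.HubbardSuperconductivity.Theorems.VisonPairCost

end
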